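import Literature.MathematicalPhysics.QuantumLattice.MagneticHubbardTorusPeierls
import Literature.MathematicalPhysics.QuantumLattice.FermionHopAmplitudeBound
import Literature.MathematicalPhysics.QuantumLattice.FinDimSpectrumSectorGibbsLimit
import HarnessLib

/-!
# Bloch's bound on the flux envelope of the Hubbard torus: `E^T_L(θ) ≤ E^T_L(0) + 2θ²`

Topic `Literature/MathematicalPhysics/QuantumLattice` (family `hubbard`); companion of
`HubbardTorusFlux.lean` (`fluxEnergy`), `HubbardTorusFluxGauge.lean`, `MagneticHubbardTorusGauge.lean`,
`MagneticHubbardTorusPeierls.lean`. Everything here is PROVED; no definitions, no named facts.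

Main result `fluxEnergy_le_fluxEnergy_zero_add_two_mul_sq`: for every `U, δ, θ` and every side
`L ≥ 1`, `fluxEnergy L U δ θ ≤ fluxEnergy L U δ 0 + 2θ²` — the Bloch / Lieb–Schultz–Mattis
variational bound on the energy cost of threading a flux `θ` through the torus (Bohm 1949;
Watanabe 2019 §2.2.1, §4.1: in two dimensions the twist costs `O(L_y/L_x) = O(1)`).

Proof:
* `L ≥ 3`: the seam flux is gauge-equivalent to the uniform twist `e^{iθ/L}` on every `e₁`-bond
  (`fluxEnergy_eq_minEnergyOn_uniformTwistConfig`); pricing any unit sector vector `ψ` in the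
  twisted Hamiltonian gives `E^T(±θ) ≤ Re⟨ψ,Hψ⟩ + 2(1 − cos(θ/L)) K(ψ) ± 2 sin(θ/L) J̃(ψ)`
  (`re_star_dotProduct_magneticHubbardTorus_uniformTwistConfig_mulVec`); `E^T(−θ) = E^T(θ)`
  (`fluxEnergy_neg`) kills the current term, and `|K(ψ)| ≤ 2L²` with `1 − cos(θ/L) ≤ θ²/(2L²)` gives
  `2θ²`; finally `inf` over `ψ` (`fluxEnergy_le_fluxEnergy_zero_add`).
* `L = 1, 2`: price `ψ` directly in `H + seamTwist θ`
  (`fluxEnergy_le_rayleigh_seam`: `E^T(θ) ≤ Re⟨ψ,Hψ⟩ + 2(1 − cos θ) G(ψ) + 2 sin θ G'(ψ)`,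
  `G = Σ_{y,σ} Re⟨ψ, c†_{(0,y)σ} c_{(-1,y)σ} ψ⟩`); `|G| ≤ 2` for `L = 1` (two terms of modulus `≤ 1`)
  and for `L = 2` (four hopping amplitudes between DISTINCT orbitals, each `≤ 1/2`,
  `FermionHopAmplitudeBound`), so `2(1 − cos θ)|G| ≤ 2θ²`.
* Degenerate sector (no unit vector; `sInf ∅ = 0` on both sides): `0 ≤ 0 + 2θ²`.

## References

* D. Bohm, Phys. Rev. 75 (1949) 502 (Bloch's theorem on persistent currents). [Bohm1949]
* H. Watanabe, J. Stat. Phys. 177 (2019) 717, §2.2.1 eqs. (13)–(16), §4.1. [Watanabe2019]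
* Y. Tada, T. Koma, J. Stat. Phys. 165 (2016) 455, §4. [TadaKoma2016]
* E. Lieb, T. Schultz, D. Mattis, Ann. Phys. 16 (1961) 407 (twist operator). [LiebSchultzMattisAP1961]
-/

noncomputable section

namespace Literature.MathematicalPhysics.QuantumLattice

open Matrix Finset Literature.MathematicalPhysics.QuantumFieldTheory
open scoped ComplexConjugate

variable {L : ℕ} [NeZero L]

/-! ### From variational bounds to a bound on the flux envelope -/

/-- If every unit vector `ψ` of the sector `(N_L, 0)` prices the flux `θ` at `Re⟨ψ,Hψ⟩ + c`, then
`E^T(θ) ≤ E^T(0) + c` (take `inf` over `ψ`; if the sector has no unit vector both sides are the junk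
value `sInf ∅ = 0`). [folklore] -/
theorem fluxEnergy_le_fluxEnergy_zero_add (U δ θ : ℝ) {c : ℝ} (hc : 0 ≤ c)
    (hvar : ∀ ψ ∈ szSector (Λ := FermionTorus 2 L) (2 * ⌊(1 - δ) * (L : ℝ) ^ 2 / 2⌋₊) 0,
      star ψ ⬝ᵥ ψ = 1 →
        fluxEnergy L U δ θ ≤ (star ψ ⬝ᵥ (hubbardTorus 2 L 1 U *ᵥ ψ)).re + c) :
    fluxEnergy L U δ θ ≤ fluxEnergy L U δ 0 + c := by
  set K := szSector (Λ := FermionTorus 2 L) (2 * ⌊(1 - δ) * (L : ℝ) ^ 2 / 2⌋₊) 0 with hK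
  by_cases hne : ∃ ψ ∈ K, star ψ ⬝ᵥ ψ = (1 : ℂ)
  · obtain ⟨ψ₀, hψ₀, h₀⟩ := hne
    have hS : {E : ℝ | ∃ ψ ∈ K, star ψ ⬝ᵥ ψ = 1 ∧
        E = (star ψ ⬝ᵥ (hubbardTorus 2 L 1 U *ᵥ ψ)).re}.Nonempty := ⟨_, ψ₀, hψ₀, h₀, rfl⟩
    have h0 : fluxEnergy L U δ 0 = sInf {E : ℝ | ∃ ψ ∈ K, star ψ ⬝ᵥ ψ = 1 ∧
        E = (star ψ ⬝ᵥ (hubbardTorus 2 L 1 U *ᵥ ψ)).re} := by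
      rw [fluxEnergy_eq, hubbardTorusFlux_zero]; rfl
    refine le_of_forall_pos_lt_add fun ε hε => ?_
    obtain ⟨E, ⟨ψ, hψ, h1, rfl⟩, hE⟩ :=
      exists_lt_of_csInf_lt hS (lt_add_of_pos_right (sInf {E : ℝ | ∃ ψ ∈ K, star ψ ⬝ᵥ ψ = 1 ∧
        E = (star ψ ⬝ᵥ (hubbardTorus 2 L 1 U *ᵥ ψ)).re}) hε)
    have h := hvar ψ hψ h1
    rw [h0]
    linarith
  · have hempty : ∀ A : Matrix (Finset (Orb (FermionTorus 2 L))) (Finset (Orb (FermionTorus 2 L))) ℂ,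
        A.minEnergyOn K = 0 := fun A => by
      unfold Matrix.minEnergyOn
      convert Real.sInf_empty
      ext E
      simp only [Set.mem_setOf_eq, Set.mem_empty_iff_false, iff_false, not_exists, not_and]
      exact fun ψ hψ h1 _ => hne ⟨ψ, hψ, h1⟩
    rw [fluxEnergy_eq, fluxEnergy_eq, hempty, hempty]
    linarith

/-- The `±` trick: if `E^T(±θ) ≤ R + C ± S` then `E^T(θ) ≤ R + C` (`E^T` is even in the flux,
`fluxEnergy_neg`; Watanabe 2019 §2.2.1 averages the two twists `U_{±m}`). [folklore] -/
theorem fluxEnergy_le_of_pm (U δ θ R C S : ℝ)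
    (hp : fluxEnergy L U δ θ ≤ R + C + S) (hm : fluxEnergy L U δ (-θ) ≤ R + C - S) :
    fluxEnergy L U δ θ ≤ R + C := by
  rw [fluxEnergy_neg] at hm
  linarith

/-- `2(1 − cos u) B ≤ u² B` for `0 ≤ B`, i.e. `1 − cos u ≤ u²/2`. [folklore] -/
theorem two_mul_one_sub_cos_mul_le (u B : ℝ) (hB : 0 ≤ B) : 2 * (1 - Real.cos u) * B ≤ u ^ 2 * B := by
  have h := Real.one_sub_sq_div_two_le_cos (x := u)
  nlinarith

/-! ### `L ≥ 3`: the uniform twist -/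

/-- **Pricing the flux with the uniform twist** (`L ≥ 3`): for every unit vector `ψ` of the sector
`(N_L, 0)`, `E^T(θ) ≤ Re⟨ψ,Hψ⟩ + 2(1 − cos(θ/L)) K(ψ) + 2 sin(θ/L) J̃(ψ)` with
`K = Σ_{x,σ} Re h_{x,0,σ}`, `J̃ = Σ_{x,σ} Im h_{x,0,σ}`, `h_{x,0,σ} = ⟨ψ, c†_{x+e₁,σ}c_{x,σ} ψ⟩`.
Watanabe (2019) §2.2.1 eqs. (13)–(16). [cite: Watanabe2019, §2.2.3 and §4.1] -/
theorem fluxEnergy_le_rayleigh_uniformTwist (hL : 3 ≤ L) (U δ θ : ℝ)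
    (ψ : Fock (Orb (FermionTorus 2 L)))
    (hψ : ψ ∈ szSector (2 * ⌊(1 - δ) * (L : ℝ) ^ 2 / 2⌋₊) 0) (h1 : star ψ ⬝ᵥ ψ = 1) :
    fluxEnergy L U δ θ ≤ (star ψ ⬝ᵥ (hubbardTorus 2 L 1 U *ᵥ ψ)).re +
      2 * (1 - Real.cos (θ / L)) *
        (∑ x : Site 2 L, ∑ σ : Fin 2,
          (star ψ ⬝ᵥ ((creation (orb (FermionTorus.ofTorusSite (Site.shift x 0)) σ) *
            annihilation (orb (FermionTorus.ofTorusSite x) σ)) *ᵥ ψ)).re) +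
      2 * Real.sin (θ / L) *
        (∑ x : Site 2 L, ∑ σ : Fin 2,
          (star ψ ⬝ᵥ ((creation (orb (FermionTorus.ofTorusSite (Site.shift x 0)) σ) *
            annihilation (orb (FermionTorus.ofTorusSite x) σ)) *ᵥ ψ)).im) := by
  rw [fluxEnergy_eq_minEnergyOn_uniformTwistConfig hL]
  refine (minEnergyOn_le_rayleigh_of_mem (magneticHubbardTorus_isHermitian _ 1 U) _ hψ h1).trans_eq ?_
  rw [re_star_dotProduct_magneticHubbardTorus_uniformTwistConfig_mulVec,
    magneticHubbardTorus_one_eq_hubbardTorus hL]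

/-- **`L ≥ 3`**: `E^T(θ) ≤ E^T(0) + 2θ²`. [cite: Watanabe2019, §2.2.3 and §4.1] -/
theorem fluxEnergy_le_of_three_le (hL : 3 ≤ L) (U δ θ : ℝ) :
    fluxEnergy L U δ θ ≤ fluxEnergy L U δ 0 + 2 * θ ^ 2 := by
  refine fluxEnergy_le_fluxEnergy_zero_add U δ θ (by positivity) fun ψ hψ h1 => ?_
  have hL0 : (0 : ℝ) < L := Nat.cast_pos.2 (NeZero.pos L)
  set K : ℝ := ∑ x : Site 2 L, ∑ σ : Fin 2,
    (star ψ ⬝ᵥ ((creation (orb (FermionTorus.ofTorusSite (Site.shift x 0)) σ) *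
      annihilation (orb (FermionTorus.ofTorusSite x) σ)) *ᵥ ψ)).re with hK
  have hKle : |K| ≤ 2 * (L : ℝ) ^ 2 := abs_sum_re_hop_le h1
  have hp := fluxEnergy_le_rayleigh_uniformTwist hL U δ θ ψ hψ h1
  have hm := fluxEnergy_le_rayleigh_uniformTwist hL U δ (-θ) ψ hψ h1
  rw [neg_div, Real.cos_neg, Real.sin_neg] at hm
  have hpm := fluxEnergy_le_of_pm U δ θ _ _ _ hp (by linarith)
  -- `2(1 − cos(θ/L)) K ≤ 2(1 − cos(θ/L)) |K| ≤ (θ/L)² · 2L² = 2θ²`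
  have hc : 0 ≤ 1 - Real.cos (θ / L) := sub_nonneg.2 (Real.cos_le_one _)
  have hstep : 2 * (1 - Real.cos (θ / L)) * K ≤ 2 * θ ^ 2 :=
    calc 2 * (1 - Real.cos (θ / L)) * K ≤ 2 * (1 - Real.cos (θ / L)) * |K| := by
          have := le_abs_self K; nlinarith
      _ ≤ (θ / L) ^ 2 * |K| := two_mul_one_sub_cos_mul_le _ _ (abs_nonneg K)
      _ ≤ (θ / L) ^ 2 * (2 * (L : ℝ) ^ 2) := by gcongr
      _ = 2 * θ ^ 2 := by field_simp
  linarith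

/-! ### `L = 1, 2`: pricing in the seam gauge -/

/-- A scalar identity: `Re[(1 − e^{iθ}) g] + Re[(1 − e^{−iθ}) conj g] = 2(1 − cos θ) Re g + 2 sin θ Im g`.
[folklore] -/
private theorem re_seam_scalar (θ : ℝ) (g : ℂ) :
    ((1 - Complex.exp ((θ : ℂ) * Complex.I)) * g).re +
        ((1 - Complex.exp (((-θ : ℝ) : ℂ) * Complex.I)) * (starRingEnd ℂ) g).re =
      2 * (1 - Real.cos θ) * g.re + 2 * Real.sin θ * g.im := by
  simp only [Complex.mul_re, Complex.sub_re, Complex.sub_im, Complex.one_re,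
    Complex.one_im, Complex.exp_ofReal_mul_I_re, Complex.exp_ofReal_mul_I_im, Complex.conj_re,
    Complex.conj_im, Real.cos_neg, Real.sin_neg]
  ring

/-- The two seam Peierls coefficients, normalised. [folklore] -/
private theorem seam_coeff_true (θ : ℝ) :
    (1 - Complex.exp ((if true then 1 else -1) * Complex.I * (θ : ℂ))) =
      1 - Complex.exp ((θ : ℂ) * Complex.I) := by
  congr 2
  simp only [if_true, one_mul]
  exact mul_comm _ _

/-- The two seam Peierls coefficients, normalised. [folklore] -/
private theorem seam_coeff_false (θ : ℝ) :
    (1 - Complex.exp ((if false then 1 else -1) * Complex.I * (θ : ℂ))) =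
      1 - Complex.exp (((-θ : ℝ) : ℂ) * Complex.I) := by
  congr 2
  simp only [Bool.false_eq_true, if_false, Complex.ofReal_neg]
  ring

/-- **Pricing the flux in the seam gauge** (every `L ≥ 1`): for every unit vector `ψ` of the sector
`(N_L, 0)`, `E^T(θ) ≤ Re⟨ψ,Hψ⟩ + 2(1 − cos θ) G(ψ) + 2 sin θ G'(ψ)` with
`G = Σ_{y,σ} Re g_{y,σ}`, `G' = Σ_{y,σ} Im g_{y,σ}`, `g_{y,σ} = ⟨ψ, c†_{(0,y)σ} c_{(-1,y)σ} ψ⟩`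
(the seam twist in expectation). Watanabe (2019) §2.2.3. [cite: Watanabe2019, §2.2.3 and §4.1] -/
theorem fluxEnergy_le_rayleigh_seam (U δ θ : ℝ) (ψ : Fock (Orb (FermionTorus 2 L)))
    (hψ : ψ ∈ szSector (2 * ⌊(1 - δ) * (L : ℝ) ^ 2 / 2⌋₊) 0) (h1 : star ψ ⬝ᵥ ψ = 1) :
    fluxEnergy L U δ θ ≤ (star ψ ⬝ᵥ (hubbardTorus 2 L 1 U *ᵥ ψ)).re +
      2 * (1 - Real.cos θ) *
        (∑ y : ZMod L, ∑ σ : Fin 2,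
          (star ψ ⬝ᵥ ((creation (orb (FermionTorus.ofTorusSite ![0, y]) σ) *
            annihilation (orb (FermionTorus.ofTorusSite ![-1, y]) σ)) *ᵥ ψ)).re) +
      2 * Real.sin θ *
        (∑ y : ZMod L, ∑ σ : Fin 2,
          (star ψ ⬝ᵥ ((creation (orb (FermionTorus.ofTorusSite ![0, y]) σ) *
            annihilation (orb (FermionTorus.ofTorusSite ![-1, y]) σ)) *ᵥ ψ)).im) := by
  rw [fluxEnergy_eq]
  refine (minEnergyOn_le_rayleigh_of_mem (isHermitian_hubbardTorusFlux L U θ) _ hψ h1).trans_eq ?_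
  rw [hubbardTorusFlux_eq, add_mulVec, dotProduct_add, Complex.add_re, add_assoc, add_right_inj,
    seamTwist_eq]
  simp only [Matrix.sum_mulVec, dotProduct_sum, Complex.re_sum, Finset.mul_sum, ← Finset.sum_add_distrib]
  refine Finset.sum_congr rfl fun y _ => Finset.sum_congr rfl fun σ _ => ?_
  rw [Fintype.sum_bool, smul_mulVec, smul_mulVec, dotProduct_smul, dotProduct_smul, smul_eq_mul,
    smul_eq_mul, seam_coeff_true, seam_coeff_false]
  simp only [if_true, Bool.false_eq_true, if_false]
  rw [star_dotProduct_creation_mul_annihilation_mulVec_swap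
      (orb (FermionTorus.ofTorusSite ![0, y]) σ) (orb (FermionTorus.ofTorusSite ![-1, y]) σ),
    re_seam_scalar]

/-- **Seam gauge, after the `±` trick**: `E^T(θ) ≤ Re⟨ψ,Hψ⟩ + θ² Σ_{y,σ} |Re g_{y,σ}(ψ)|`. [cite: Watanabe2019, §2.2.3 and §4.1] -/
theorem fluxEnergy_le_rayleigh_add_sq_mul_sum_abs (U δ θ : ℝ) (ψ : Fock (Orb (FermionTorus 2 L)))
    (hψ : ψ ∈ szSector (2 * ⌊(1 - δ) * (L : ℝ) ^ 2 / 2⌋₊) 0) (h1 : star ψ ⬝ᵥ ψ = 1) :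
    fluxEnergy L U δ θ ≤ (star ψ ⬝ᵥ (hubbardTorus 2 L 1 U *ᵥ ψ)).re +
      θ ^ 2 * ∑ y : ZMod L, ∑ σ : Fin 2,
        |(star ψ ⬝ᵥ ((creation (orb (FermionTorus.ofTorusSite ![0, y]) σ) *
          annihilation (orb (FermionTorus.ofTorusSite ![-1, y]) σ)) *ᵥ ψ)).re| := by
  set G : ℝ := ∑ y : ZMod L, ∑ σ : Fin 2,
    (star ψ ⬝ᵥ ((creation (orb (FermionTorus.ofTorusSite ![0, y]) σ) *
      annihilation (orb (FermionTorus.ofTorusSite ![-1, y]) σ)) *ᵥ ψ)).re with hG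
  have hp := fluxEnergy_le_rayleigh_seam U δ θ ψ hψ h1
  have hm := fluxEnergy_le_rayleigh_seam U δ (-θ) ψ hψ h1
  rw [Real.cos_neg, Real.sin_neg] at hm
  have hpm := fluxEnergy_le_of_pm U δ θ _ _ _ hp (by linarith)
  have hGabs : |G| ≤ ∑ y : ZMod L, ∑ σ : Fin 2,
      |(star ψ ⬝ᵥ ((creation (orb (FermionTorus.ofTorusSite ![0, y]) σ) *
        annihilation (orb (FermionTorus.ofTorusSite ![-1, y]) σ)) *ᵥ ψ)).re| :=
    (Finset.abs_sum_le_sum_abs _ _).trans (Finset.sum_le_sum fun y _ => Finset.abs_sum_le_sum_abs _ _)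
  have hc : 0 ≤ 1 - Real.cos θ := sub_nonneg.2 (Real.cos_le_one _)
  have hstep : 2 * (1 - Real.cos θ) * G ≤ θ ^ 2 * |G| :=
    calc 2 * (1 - Real.cos θ) * G ≤ 2 * (1 - Real.cos θ) * |G| := by
          have := le_abs_self G; nlinarith
      _ ≤ θ ^ 2 * |G| := two_mul_one_sub_cos_mul_le _ _ (abs_nonneg G)
  have hθ : 0 ≤ θ ^ 2 := sq_nonneg θ
  nlinarith

/-- **`L = 1`**: `E^T(θ) ≤ E^T(0) + 2θ²` (two seam terms of modulus `≤ 1`). [cite: Watanabe2019, §2.2.3 and §4.1] -/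
theorem fluxEnergy_le_of_eq_one (hL : L = 1) (U δ θ : ℝ) :
    fluxEnergy L U δ θ ≤ fluxEnergy L U δ 0 + 2 * θ ^ 2 := by
  refine fluxEnergy_le_fluxEnergy_zero_add U δ θ (by positivity) fun ψ hψ h1 => ?_
  refine (fluxEnergy_le_rayleigh_add_sq_mul_sum_abs U δ θ ψ hψ h1).trans ?_
  have hsum : ∑ y : ZMod L, ∑ σ : Fin 2,
      |(star ψ ⬝ᵥ ((creation (orb (FermionTorus.ofTorusSite ![0, y]) σ) *
        annihilation (orb (FermionTorus.ofTorusSite ![-1, y]) σ)) *ᵥ ψ)).re| ≤ 2 := by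
    have hterm : ∀ y ∈ (Finset.univ : Finset (ZMod L)), ∑ σ : Fin 2,
        |(star ψ ⬝ᵥ ((creation (orb (FermionTorus.ofTorusSite ![0, y]) σ) *
          annihilation (orb (FermionTorus.ofTorusSite ![-1, y]) σ)) *ᵥ ψ)).re| ≤ 2 := fun y _ => by
      refine (Finset.sum_le_sum fun σ _ =>
        abs_re_star_dotProduct_creation_mul_annihilation_mulVec_le h1 _ _).trans ?_
      simp
    refine (Finset.sum_le_sum hterm).trans ?_
    rw [Finset.sum_const, Finset.card_univ, ZMod.card, hL]
    simp
  have hθ : 0 ≤ θ ^ 2 := sq_nonneg θ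
  nlinarith

/-- For `L ≥ 2` the two ends of a seam bond are distinct orbitals. [folklore] -/
theorem orb_seam_ne (hL : 2 ≤ L) (y : ZMod L) (σ : Fin 2) :
    orb (FermionTorus.ofTorusSite (![0, y] : Site 2 L)) σ ≠
      orb (FermionTorus.ofTorusSite (![-1, y] : Site 2 L)) σ := by
  intro h
  have h' : (FermionTorus.ofTorusSite (![0, y] : Site 2 L)) = FermionTorus.ofTorusSite ![-1, y] :=
    congrArg (fun o : Orb (FermionTorus 2 L) => (ofLex o).1) h
  have h'' := congrArg FermionTorus.toTorusSite h'
  rw [FermionTorus.toTorusSite_ofTorusSite, FermionTorus.toTorusSite_ofTorusSite] at h''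
  have h0 : (0 : ZMod L) = -1 := by simpa using congrFun h'' 0
  have h1 : (1 : ZMod L) = 0 := neg_eq_zero.mp h0.symm
  haveI : Fact (1 < L) := ⟨hL⟩
  exact one_ne_zero h1

/-- **`L = 2`**: `E^T(θ) ≤ E^T(0) + 2θ²` (four seam hopping amplitudes between distinct orbitals,
each of modulus `≤ 1/2`). [cite: Watanabe2019, §2.2.3 and §4.1] -/
theorem fluxEnergy_le_of_eq_two (hL : L = 2) (U δ θ : ℝ) :
    fluxEnergy L U δ θ ≤ fluxEnergy L U δ 0 + 2 * θ ^ 2 := by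
  refine fluxEnergy_le_fluxEnergy_zero_add U δ θ (by positivity) fun ψ hψ h1 => ?_
  refine (fluxEnergy_le_rayleigh_add_sq_mul_sum_abs U δ θ ψ hψ h1).trans ?_
  have hsum : ∑ y : ZMod L, ∑ σ : Fin 2,
      |(star ψ ⬝ᵥ ((creation (orb (FermionTorus.ofTorusSite ![0, y]) σ) *
        annihilation (orb (FermionTorus.ofTorusSite ![-1, y]) σ)) *ᵥ ψ)).re| ≤ 2 := by
    have hterm : ∀ y ∈ (Finset.univ : Finset (ZMod L)), ∑ σ : Fin 2,
        |(star ψ ⬝ᵥ ((creation (orb (FermionTorus.ofTorusSite ![0, y]) σ) *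
          annihilation (orb (FermionTorus.ofTorusSite ![-1, y]) σ)) *ᵥ ψ)).re| ≤ 1 := fun y _ => by
      refine (Finset.sum_le_sum fun σ _ =>
        abs_re_star_dotProduct_creation_mul_annihilation_mulVec_le_half h1
          (orb_seam_ne (by omega) y σ)).trans ?_
      norm_num
    refine (Finset.sum_le_sum hterm).trans ?_
    rw [Finset.sum_const, Finset.card_univ, ZMod.card, hL]
    simp
  have hθ : 0 ≤ θ ^ 2 := sq_nonneg θ
  nlinarith

/-! ### Assembly -/

/-- **Bloch bound, all sides**: `fluxEnergy L U δ θ ≤ fluxEnergy L U δ 0 + 2θ²` for every `L ≥ 1`. [cite: Watanabe2019, §2.2.3 and §4.1] -/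
theorem fluxEnergy_le_fluxEnergy_zero_add_two_mul_sq (U δ θ : ℝ) :
    fluxEnergy L U δ θ ≤ fluxEnergy L U δ 0 + 2 * θ ^ 2 := by
  have hL : 1 ≤ L := NeZero.one_le
  rcases Nat.lt_or_ge L 3 with h | h
  · interval_cases L
    · exact fluxEnergy_le_of_eq_one rfl U δ θ
    · exact fluxEnergy_le_of_eq_two rfl U δ θ
  · exact fluxEnergy_le_of_three_le h U δ θ

end Literature.MathematicalPhysics.QuantumLattice
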